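import Literature.Probability.Percolation.SharpnessDCTProofs
import Literature.Probability.Percolation.SeedLemma
import Literature.Probability.Percolation.RSW
import Literature.Probability.Percolation.BernoulliPercolation
import Literature.Probability.Percolation.HalfSpaceHighDimStar
import Literature.Probability.LatticeModels.ThermodynamicLimit
import HarnessLib

/-!
# Crux `PercNonProliferation.FreeBoxPowerSaving` (stmt-CriticalPhenomena-4447), line
# `Sketch-r2-ideator5` (card `subcritical-runaway-closure`) — stub `stub_layerGain`

Helper file for the checked skeleton of the crux `FreeBoxPowerSaving` (route
`PercNonProliferation`), line `Sketch-r2-ideator5`.  Proves exactly the registered stub signature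
`stub_layerGain` (the LAYER GAIN `S_p(n) + 2p·W_∂(p,n) ≤ S_p(n+1)`); lands with
`--supports stmt-CriticalPhenomena-4447`.

## The statement

Bond percolation `P_p` on `ℤ³`, `B(n) = box 3 n = [-n, n]³`, free-box pair sum
`S_p(n) = Σ_{x, y ∈ B(n)} P_p(x ↔ y inside B(n))`, boundary weight
`W_∂(p, n) = Σ_{x ∈ B(n)} Σ_{y ∈ ∂ⁱⁿB(n)} P_p(x ↔ y inside B(n))`.  For every `p`, `n`:
`S_p(n) + 2 p W_∂(p, n) ≤ S_p(n+1)`.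

## The argument (every `p`, `n`)

Write `B = B(n) ⊆ B' = B(n+1)`, `L = B' ∖ B`, `F(x, z) = P_p(x ↔ z in B') ≥ 0`.  The pair sum over
`B' × B'` splits into the four blocks `B × B`, `B × L`, `L × B`, `L × L` (`sum_sum_split`).
1. `B × B`: `P_p(x ↔ y in B) ≤ F(x, y)` (`openConnIn_mono`), giving `S_p(n)`.
2. `B × L` (`sum_boundary_le`): every foot `y ∈ ∂ⁱⁿB` has an outer neighbour `z ∈ L`
   (`exists_outer_nbr`), and `p · P_p(x ↔ y in B) ≤ F(x, z)` (`key`): indeed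
   `{x ↔ y in B} ∩ {s(y,z) open} ⊆ {x ↔ z in B'}` and the two events are independent, the first
   being determined by the pairs inside `B` (`DCT16.determinedBy_openConnIn`,
   `BGNd.determinedBy_mem_edge`, `DCT16.real_inter_of_determinedBy_disjoint`,
   `bondPercolation_cylinder`).  Conversely a point
   `z ∉ B` has at most one neighbour in `B` (`nbr_unique`: the out-of-range coordinate of `z` must
   be the one that moves), so summing over the feet double counts nothing:
   `p W_∂ ≤ Σ_{x ∈ B} Σ_{z ∈ L} F(x, z)` (`Finset.sum_comm'`, `Finset.card_le_one`).
3. `L × B`: equals the `B × L` block by the symmetry `{x ↔ z in B'} = {z ↔ x in B'}`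
   (`openConnIn_comm`, `Finset.sum_comm`), giving another `p W_∂`.
4. `L × L` is non-negative.
No new definitions.
-/

noncomputable section

open MeasureTheory
open Literature.Probability.Percolation Literature.Probability.LatticeModels
open scoped BigOperators

namespace Summit.CriticalPhenomena.PercolationContinuityZ3.FreeBoxPowerSavingLine

namespace LayerGain

/-! ### Finset bookkeeping -/

/-- Splitting a double sum over `t × t` along `s ⊆ t` into the four blocks
`s × s`, `s × (t ∖ s)`, `(t ∖ s) × s`, `(t ∖ s) × (t ∖ s)`. [folklore] -/
theorem sum_sum_split {α : Type*} [DecidableEq α] {s t : Finset α} (h : s ⊆ t) (f : α → α → ℝ) :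
    ∑ x ∈ t, ∑ y ∈ t, f x y =
      ∑ x ∈ s, ∑ y ∈ s, f x y + ∑ x ∈ s, ∑ y ∈ t \ s, f x y +
        ∑ x ∈ t \ s, ∑ y ∈ s, f x y + ∑ x ∈ t \ s, ∑ y ∈ t \ s, f x y := by
  have inner : ∀ x, ∑ y ∈ t, f x y = ∑ y ∈ t \ s, f x y + ∑ y ∈ s, f x y := fun x =>
    (Finset.sum_sdiff h).symm
  rw [← Finset.sum_sdiff h]
  simp only [inner, Finset.sum_add_distrib]
  ring

/-! ### `ℤ^d` box geometry: neighbours across the boundary of `B(n)` -/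

/-- A neighbour of a point of `B(n)` lies in `B(n+1)`. [folklore] -/
theorem mem_box_succ_of_adj {d n : ℕ} {y z : Site d} (hy : y ∈ box d n)
    (hadj : (zdGraph d).Adj y z) : z ∈ box d (n + 1) := by
  rw [zdGraph_adj_iff] at hadj
  rw [mem_box] at hy ⊢
  intro j
  obtain ⟨h1, h2⟩ := hy j
  obtain ⟨k, hk | hk⟩ := hadj
  · have hzj : z j = y j + if j = k then 1 else 0 := by
      rw [hk, Pi.add_apply, Pi.single_apply]
    push_cast
    split_ifs at hzj <;> omega
  · have hyj : y j = z j + if j = k then 1 else 0 := by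
      rw [hk, Pi.add_apply, Pi.single_apply]
    push_cast
    split_ifs at hyj <;> omega

/-- Every vertex of the inner vertex boundary of `B(n)` has a neighbour in `B(n+1) ∖ B(n)`.
[folklore] -/
theorem exists_outer_nbr {n : ℕ} {y : Site 3} (hy : y ∈ innerBoundary (zdGraph 3) (box 3 n)) :
    ∃ z, z ∈ box 3 (n + 1) \ box 3 n ∧ (zdGraph 3).Adj y z := by
  rw [mem_innerBoundary_iff] at hy
  obtain ⟨hyB, z, hzB, hadj⟩ := hy
  exact ⟨z, Finset.mem_sdiff.2 ⟨mem_box_succ_of_adj hyB hadj, hzB⟩, hadj⟩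

/-- If `y ∈ B(n)` is adjacent to `z` and the coordinate `z i` is out of the range `[-n, n]`, then
`z i = ±(n+1)` and `y = z ∓ e_i`: the out-of-range coordinate is the one that moves. [folklore] -/
theorem eq_of_adj_of_coord_out {d n : ℕ} {y z : Site d} (hy : y ∈ box d n) {i : Fin d}
    (hi : z i < -(n : ℤ) ∨ (n : ℤ) < z i) (hadj : (zdGraph d).Adj y z) :
    (z i = n + 1 ∧ y = z - Pi.single i 1) ∨ (z i = -(n + 1) ∧ y = z + Pi.single i 1) := by
  rw [zdGraph_adj_iff] at hadj
  rw [mem_box] at hy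
  have hyi := hy i
  obtain ⟨k, hk | hk⟩ := hadj
  · have hzi : z i = y i + if i = k then 1 else 0 := by
      rw [hk, Pi.add_apply, Pi.single_apply]
    by_cases hik : i = k
    · rw [if_pos hik] at hzi
      rw [← hik] at hk
      exact Or.inl ⟨by omega, by rw [hk, add_sub_cancel_right]⟩
    · rw [if_neg hik] at hzi
      omega
  · have hyi' : y i = z i + if i = k then 1 else 0 := by
      rw [hk, Pi.add_apply, Pi.single_apply]
    by_cases hik : i = k
    · rw [if_pos hik] at hyi'
      rw [← hik] at hk
      exact Or.inr ⟨by omega, hk⟩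
    · rw [if_neg hik] at hyi'
      omega

/-- A point outside `B(n)` has at most one neighbour inside `B(n)`. [folklore] -/
theorem nbr_unique {d n : ℕ} {y y' z : Site d} (hy : y ∈ box d n) (hy' : y' ∈ box d n)
    (hzB : z ∉ box d n) (h : (zdGraph d).Adj y z) (h' : (zdGraph d).Adj y' z) : y = y' := by
  obtain ⟨i, hi⟩ : ∃ i, z i < -(n : ℤ) ∨ (n : ℤ) < z i := by
    by_contra hcon
    push Not at hcon
    exact hzB (mem_box.2 fun i => ⟨(hcon i).1, (hcon i).2⟩)
  rcases eq_of_adj_of_coord_out hy hi h with ⟨h1, h2⟩ | ⟨h1, h2⟩ <;>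
    rcases eq_of_adj_of_coord_out hy' hi h' with ⟨h1', h2'⟩ | ⟨h1', h2'⟩
  · rw [h2, h2']
  · omega
  · omega
  · rw [h2, h2']

/-- For `z ∉ B(n)`, at most one foot `y ∈ ∂ⁱⁿB(n)` is adjacent to `z`. [folklore] -/
theorem card_filter_adj_le_one {n : ℕ} {z : Site 3} (hzB : z ∉ box 3 n) :
    ((innerBoundary (zdGraph 3) (box 3 n)).filter (fun y => (zdGraph 3).Adj y z)).card ≤ 1 := by
  refine Finset.card_le_one.2 fun a ha b hb => ?_
  rw [Finset.mem_filter, mem_innerBoundary_iff] at ha hb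
  exact nbr_unique ha.1.1 hb.1.1 hzB ha.2 hb.2

/-- **Boundary-to-layer bookkeeping.**  If `c · a(x, y) ≤ F(x, z)` whenever `y ∈ B(n)` and
`z ∈ B(n+1) ∖ B(n)` are adjacent, with `F ≥ 0`, then
`c · Σ_{x ∈ B(n)} Σ_{y ∈ ∂ⁱⁿB(n)} a(x, y) ≤ Σ_{x ∈ B(n)} Σ_{z ∈ B(n+1) ∖ B(n)} F(x, z)`:
each foot has an outer neighbour (`exists_outer_nbr`) and each outer point has at most one foot
(`card_filter_adj_le_one`). [folklore] -/
theorem sum_boundary_le {n : ℕ} (c : ℝ) (a F : Site 3 → Site 3 → ℝ) (hF : ∀ x z, 0 ≤ F x z)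
    (hkey : ∀ x y z, y ∈ box 3 n → z ∈ box 3 (n + 1) → z ∉ box 3 n → (zdGraph 3).Adj y z →
      c * a x y ≤ F x z) :
    c * (∑ x ∈ box 3 n, ∑ y ∈ innerBoundary (zdGraph 3) (box 3 n), a x y) ≤
      ∑ x ∈ box 3 n, ∑ z ∈ box 3 (n + 1) \ box 3 n, F x z := by
  rw [Finset.mul_sum]
  refine Finset.sum_le_sum fun x _ => ?_
  rw [Finset.mul_sum]
  calc ∑ y ∈ innerBoundary (zdGraph 3) (box 3 n), c * a x y
      ≤ ∑ y ∈ innerBoundary (zdGraph 3) (box 3 n),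
          ∑ z ∈ (box 3 (n + 1) \ box 3 n).filter (fun z => (zdGraph 3).Adj y z), F x z := by
        refine Finset.sum_le_sum fun y hy => ?_
        obtain ⟨z, hz, hadj⟩ := exists_outer_nbr hy
        obtain ⟨hzB', hzB⟩ := Finset.mem_sdiff.1 hz
        calc c * a x y ≤ F x z := hkey x y z (mem_innerBoundary_iff.1 hy).1 hzB' hzB hadj
          _ ≤ ∑ z ∈ (box 3 (n + 1) \ box 3 n).filter (fun z => (zdGraph 3).Adj y z), F x z :=
              Finset.single_le_sum (f := fun z => F x z) (fun _ _ => hF _ _)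
                (Finset.mem_filter.2 ⟨hz, hadj⟩)
    _ = ∑ z ∈ box 3 (n + 1) \ box 3 n,
          ∑ _y ∈ (innerBoundary (zdGraph 3) (box 3 n)).filter (fun y => (zdGraph 3).Adj y z),
            F x z := by
        refine Finset.sum_comm' fun y z => ?_
        simp only [Finset.mem_filter]
        tauto
    _ ≤ ∑ z ∈ box 3 (n + 1) \ box 3 n, F x z := by
        refine Finset.sum_le_sum fun z hz => ?_
        rw [Finset.sum_const, nsmul_eq_mul]
        have hc : (((innerBoundary (zdGraph 3) (box 3 n)).filter
            (fun y => (zdGraph 3).Adj y z)).card : ℝ) ≤ 1 := by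
          exact_mod_cast card_filter_adj_le_one (Finset.mem_sdiff.1 hz).2
        have hFz := hF x z
        nlinarith

/-! ### The one-edge extension estimate -/

/-- **Key estimate.**  For `y ∈ B(n)` adjacent to `z ∈ B(n+1) ∖ B(n)` and any `x`:
`p · P_p(x ↔ y in B(n)) ≤ P_p(x ↔ z in B(n+1))`.  Indeed
`{x ↔ y in B(n)} ∩ {s(y,z) open} ⊆ {x ↔ z in B(n+1)}` (the path, then the edge), the first event is
determined by the pairs inside `B(n)` and the second by the pair `s(y, z) ∉ B(n).sym2`
(`BGNd.determinedBy_mem_edge`), so they are independent (Grimmett 1999, §2.2) and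
`P_p{s(y,z) open} = p`. [folklore] -/
theorem key (p : unitInterval) {n : ℕ} {x y z : Site 3} (hy : y ∈ box 3 n)
    (hz : z ∈ box 3 (n + 1)) (hzB : z ∉ box 3 n) (hadj : (zdGraph 3).Adj y z) :
    (p : ℝ) * (bondPercolation (zdGraph 3) p).real (openConnIn (↑(box 3 n) : Set (Site 3)) x y) ≤
      (bondPercolation (zdGraph 3) p).real (openConnIn (↑(box 3 (n + 1)) : Set (Site 3)) x z) := by
  have hA : DeterminedBy (openConnIn (↑(box 3 n) : Set (Site 3)) x y)
      (↑(box 3 n).sym2 : Set (Sym2 (Site 3))) :=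
    DCT16.determinedBy_openConnIn _ x y (by rw [Finset.coe_sym2])
  have hE : DeterminedBy {ω : BondConfig (Site 3) | s(y, z) ∈ ω}
      (↑({s(y, z)} : Finset (Sym2 (Site 3))) : Set (Sym2 (Site 3))) := by
    rw [Finset.coe_singleton]
    exact BGNd.determinedBy_mem_edge _
  have hdisj : Disjoint (box 3 n).sym2 ({s(y, z)} : Finset (Sym2 (Site 3))) := by
    rw [Finset.disjoint_singleton_right, Finset.mk_mem_sym2_iff]
    exact fun h => hzB h.2
  have hinter := DCT16.real_inter_of_determinedBy_disjoint (zdGraph 3) p hA hE hdisj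
  have hcyl : (bondPercolation (zdGraph 3) p).real {ω : BondConfig (Site 3) | s(y, z) ∈ ω} = p :=
    bondPercolation_cylinder (zdGraph 3) p ((SimpleGraph.mem_edgeSet _).2 hadj)
  have hBB : (↑(box 3 n) : Set (Site 3)) ⊆ ↑(box 3 (n + 1)) :=
    Finset.coe_subset.2 (box_mono 3 (Nat.le_succ n))
  have hsub : openConnIn (↑(box 3 n) : Set (Site 3)) x y ∩ {ω : BondConfig (Site 3) | s(y, z) ∈ ω} ⊆
      openConnIn (↑(box 3 (n + 1)) : Set (Site 3)) x z := by
    rintro ω ⟨h1, h2⟩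
    refine GM.openConnIn_trans (openConnIn_mono hBB x y h1) ?_
    exact GM.openConnIn_of_adj (hBB (Finset.mem_coe.2 hy)) (Finset.mem_coe.2 hz)
      ((openGraph_adj ω y z).2 ⟨h2, hadj.ne⟩)
  calc (p : ℝ) * (bondPercolation (zdGraph 3) p).real (openConnIn (↑(box 3 n) : Set (Site 3)) x y)
      = (bondPercolation (zdGraph 3) p).real
          (openConnIn (↑(box 3 n) : Set (Site 3)) x y ∩ {ω : BondConfig (Site 3) | s(y, z) ∈ ω}) := by
        rw [hinter, hcyl, mul_comm]
    _ ≤ (bondPercolation (zdGraph 3) p).real (openConnIn (↑(box 3 (n + 1)) : Set (Site 3)) x z) :=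
        measureReal_mono hsub (measure_ne_top _ _)

end LayerGain

open LayerGain

/-- **stub_layerGain (LAYER GAIN; every `p`, `n`; line `Sketch-r2-ideator5` of crux
`FreeBoxPowerSaving`).**  `S_p(n) + 2p·W_∂(p,n) ≤ S_p(n+1)`: split the pairs of `B(n+1)` into the
blocks `B × B`, `B × L`, `L × B`, `L × L` (`B = B(n)`, `L = B(n+1) ∖ B(n)`); pairs inside `B` give
`≥ S_p(n)` (monotonicity of `{x ↔ y in S}` in `S`); for `x ∈ B`, `y ∈ ∂ⁱⁿB` and an outer neighbour
`z ∈ L` of `y`, `{x ↔ y in B} ∩ {s(y,z) open} ⊆ {x ↔ z in B(n+1)}` with the two events independent,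
so `p · P(x ↔ y in B) ≤ P(x ↔ z in B(n+1))`, and an outer point has at most one neighbour in `B`, so
the `B × L` block is `≥ p W_∂` (`sum_boundary_le`, `key`); the `L × B` block equals it by symmetry
(`openConnIn_comm`). (Grimmett 1999, §§1.6, 2.2.) [folklore] -/
theorem stub_layerGain :
    ∀ (p : unitInterval) (n : ℕ),
      (∑ x ∈ box 3 n, ∑ y ∈ box 3 n,
          (bondPercolation (zdGraph 3) p).real (openConnIn (↑(box 3 n) : Set (Site 3)) x y)) +
        2 * (p : ℝ) *
          (∑ x ∈ box 3 n, ∑ y ∈ innerBoundary (zdGraph 3) (box 3 n),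
            (bondPercolation (zdGraph 3) p).real (openConnIn (↑(box 3 n) : Set (Site 3)) x y)) ≤
      ∑ x ∈ box 3 (n + 1), ∑ y ∈ box 3 (n + 1),
        (bondPercolation (zdGraph 3) p).real (openConnIn (↑(box 3 (n + 1)) : Set (Site 3)) x y) := by
  intro p n
  have hsub : box 3 n ⊆ box 3 (n + 1) := box_mono 3 (Nat.le_succ n)
  have hcoe : (↑(box 3 n) : Set (Site 3)) ⊆ ↑(box 3 (n + 1)) := Finset.coe_subset.2 hsub
  have hS : (∑ x ∈ box 3 n, ∑ y ∈ box 3 n,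
      (bondPercolation (zdGraph 3) p).real (openConnIn (↑(box 3 n) : Set (Site 3)) x y)) ≤
      ∑ x ∈ box 3 n, ∑ y ∈ box 3 n,
        (bondPercolation (zdGraph 3) p).real (openConnIn (↑(box 3 (n + 1)) : Set (Site 3)) x y) :=
    Finset.sum_le_sum fun x _ => Finset.sum_le_sum fun y _ =>
      measureReal_mono (openConnIn_mono hcoe x y) (measure_ne_top _ _)
  have hW : (p : ℝ) * (∑ x ∈ box 3 n, ∑ y ∈ innerBoundary (zdGraph 3) (box 3 n),
      (bondPercolation (zdGraph 3) p).real (openConnIn (↑(box 3 n) : Set (Site 3)) x y)) ≤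
      ∑ x ∈ box 3 n, ∑ z ∈ box 3 (n + 1) \ box 3 n,
        (bondPercolation (zdGraph 3) p).real (openConnIn (↑(box 3 (n + 1)) : Set (Site 3)) x z) :=
    sum_boundary_le (p : ℝ)
      (fun x y => (bondPercolation (zdGraph 3) p).real (openConnIn (↑(box 3 n) : Set (Site 3)) x y))
      (fun x z => (bondPercolation (zdGraph 3) p).real
        (openConnIn (↑(box 3 (n + 1)) : Set (Site 3)) x z))
      (fun _ _ => measureReal_nonneg) (fun _ _ _ hy hz hzB hadj => key p hy hz hzB hadj)
  have hT : ∑ x ∈ box 3 (n + 1) \ box 3 n, ∑ y ∈ box 3 n,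
      (bondPercolation (zdGraph 3) p).real (openConnIn (↑(box 3 (n + 1)) : Set (Site 3)) x y) =
      ∑ x ∈ box 3 n, ∑ z ∈ box 3 (n + 1) \ box 3 n,
        (bondPercolation (zdGraph 3) p).real (openConnIn (↑(box 3 (n + 1)) : Set (Site 3)) x z) := by
    rw [Finset.sum_comm]
    refine Finset.sum_congr rfl fun x _ => Finset.sum_congr rfl fun z _ => ?_
    rw [openConnIn_comm]
  have hL : 0 ≤ ∑ x ∈ box 3 (n + 1) \ box 3 n, ∑ y ∈ box 3 (n + 1) \ box 3 n,
      (bondPercolation (zdGraph 3) p).real (openConnIn (↑(box 3 (n + 1)) : Set (Site 3)) x y) :=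
    Finset.sum_nonneg fun _ _ => Finset.sum_nonneg fun _ _ => measureReal_nonneg
  rw [sum_sum_split hsub]
  linarith

end Summit.CriticalPhenomena.PercolationContinuityZ3.FreeBoxPowerSavingLine

end
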